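import Summits.HodgeConjecture.HodgeConjecture.Theorems.F0P6aSpecOrgans
import Summits.HodgeConjecture.HodgeConjecture.Theorems.F0P6aStubFROBRoofMiddleDual
import Summits.HodgeConjecture.HodgeConjecture.Theorems.F0P6aLineSpecialisation
import Summits.HodgeConjecture.HodgeConjecture.Theorems.F0P6aQuotientFibreEngineInputs
import Literature.AlgebraicGeometry.AbelianSchemes.RoofLegsSpecialFibreKernelRows
import Literature.AlgebraicGeometry.AbelianSchemes.RoofLegsIsogenyOfPolarization
import Literature.AlgebraicGeometry.AbelianSchemes.RoofMiddleDualOfIdealTorsionQuotient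
import Literature.AlgebraicGeometry.AbelianSchemes.SerreTranslateCoverLeg
import Literature.AlgebraicGeometry.AbelianSchemes.AbelianSchemeConstSubgroupQuotientSmooth
import Literature.AlgebraicGeometry.AbelianSchemes.AbelianSchemeQuotientIsoOfKernelRank
import Literature.AlgebraicGeometry.AbelianSchemes.RoofLegsSpecialFibre
import Literature.AlgebraicGeometry.AbelianSchemes.SerreTensorUntwist
import Literature.AlgebraicGeometry.AbelianSchemes.RoofTargetUnique
import Literature.AlgebraicGeometry.AbelianSchemes.TupleIsoAtOfFibreIsoPoints
import Literature.AlgebraicGeometry.AbelianSchemes.LevelStructureTorsionPointsBasis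
import Literature.AlgebraicGeometry.AbelianSchemes.WeilDualityTwoBlockCut
import Literature.AlgebraicGeometry.AbelianSchemes.KernelLagrangianOfDescent
import Literature.AlgebraicGeometry.GroupSchemes.TorsionLayerBlockIdempotents
import Literature.AlgebraicGeometry.GroupSchemes.IsotropicSubgroupEqOfBlockEq
import Literature.AlgebraicGeometry.Motives.AbelianVarietyTorsionFrobeniusPins
import Literature.AlgebraicGeometry.AbelianSchemes.PolarizationUnitHypothesis
import Literature.AlgebraicGeometry.AbelianSchemes.SerreTwistBaseChange
import Summits.HodgeConjecture.HodgeConjecture.Theorems.F0P6bWDockPackage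
import Literature.AlgebraicGeometry.AbelianSchemes.SerreTensorUntwistBaseChange
import HarnessLib
import HarnessLib.Audit.LibrarySuggestionsDenyListCruxes

/-!
# `F0P6aSpecOrgansTBlockT5` — ★ RE-HOME of `Lines/F0_P6a_SpecOrgansT.lean` (tree sha16 8dca47ee93439c08, 1023 l.), PART 1 of 4 — tree lines :1–:339
K6 verbatim twin (L2 column; pen LA2-plan (g5) PLAN v1.3 Δ5 cut set of record [340, 649, 909]; hand LA2-p02 (g5), `mkparts2.py` cand.v2.LA2-p02g5): the code below this header is the tree bytes
of the stated range untouched, namespace KEPT (every fully-qualified name unchanged); later parts re-open the scopes live at their first line with their `open` ∕ `variable` ∕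
`universe` ∕ section `set_option` lines replayed verbatim (certified by one-file split rehearsal, LA2-p02 TABLE v2∕v3).  Header canonical per LEAD «M-142a» (A): bare imports only.

## Import provenance — ★ twin stems (LAST part, plain stem) replacing `Cruxes.HLiu418.Lines` imports: `F0P6aSpecOrgans` ← `Lines.F0_P6a_SpecOrgans`;
  `F0P6aStubFROBRoofMiddleDual` ← `Lines.F0_P6a_StubFROBRoofMiddleDual`; `F0P6aLineSpecialisation` ← `Lines.F0_P6a_LineSpecialisation`;
  `F0P6aQuotientFibreEngineInputs` ← `Lines.F0_P6a_QuotientFibreEngineInputs`.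
`import HarnessLib.Audit.LibrarySuggestionsDenyListCruxes` kept on this ROOT part per LEAD «M-142d» «P-κ» (parts 2… inherit it); every other import = the tree list made bare
(the trailing provenance comments of 20 import lines stay in the tree file `Lines/F0_P6a_SpecOrgansT.lean` ll. 1–24).
Original module docstring: reproduced verbatim below this header block (part of the tree bytes :1–:339).  HC_CM is proved only modulo the 7 printed citations (2 remaining: hLiu418 = stmt-HodgeConjecture-24832, h413 = stmt-HodgeConjecture-24833) until rung 0 closes; a re-home is count-neutral.
-/

/-!
# `Lines/F0_P6a_SpecOrgansT.lean` ED. 1 — PART B of the PAID organ bank of `stub_SPEC`: §T5 §Tα §D6 (HOME cand v2 e3f4d4f512983e63, LA2-p01 (g2), assembly only)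

SPLIT (LA2-plan (g2), 2026-09-02 09:5xZ): `ledger crux write` caps a workfile at 200 000 bytes and cand v2 is 224 740 bytes, so the organ bank is a CHAIN of leaflets:
PART A `Lines/F0_P6a_SpecOrgans.lean` = §K §C §I §G §R, PART B = THIS FILE = §T5 §Tα §D6 (imports PART A; same namespace; blocks BYTE-IDENTICAL to cand v2 lines 1619–2339,
each block self-contained in its `section Block_<k>` with its own `open`s and `variable` frame, exactly as boxed GREEN by LAref-D (g0) BOX L2-SPECORGANS #1 09:47:22Z, leg 550 s).
ED. 2 blocks (§Q by import of W1-b, § J, § C6Ω, §φ♭, § U) extend the chain (PART C), never this file past the cap. The L2 LEAF `Lines/F0_P6a_StubDOWN.lean` ED. 4 imports the chain's last part.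

* §T5 — (C5) `exists_translReduction` — LA2-p01 (g2) `TranslReduction.proof.v1` 5ed88408d12f3be4 §1–§3 (byte-identical)
* §Tα — (C1α)∕(C3a)∕(C3α) + (C4α)∕(T-WD) — LA6-p01 (g3) `LineSpecialisation.sec3b.alpha.v3` ed9770d7ba6ae4f3 `section CommonSourceAlpha` (MINUS `eq_of_pow_eq_pow_of_coprime`, ★) + `section TranslWDα` (its `section TranslReduction` = §T5, DEDUP)
* §D6 — D6 SHEET — LA6-p01 (g3) `QuotQuotSheet.v1` 2673ec94b3615b33 (byte-identical)

HC_CM is proved only modulo the 7 printed citations (2 remaining: hLiu418 = stmt-HodgeConjecture-24832, h413 = stmt-HodgeConjecture-24833) until rung 0 closes; count-neutral.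
-/

set_option autoImplicit false
set_option linter.dupNamespace false

noncomputable section

universe u

namespace Summit.HodgeConjecture.HodgeConjecture.Cruxes.HLiu418.F0P6aLineSpecialisation

/-! ## §T5 — (C5) `exists_translReduction` — LA2-p01 (g2) `TranslReduction.proof.v1` 5ed88408d12f3be4 §1–§3 (byte-identical) -/

section Block_T5

open CategoryTheory CategoryTheory.Limits NumberField IsDedekindDomain MulAction AlgebraicGeometry
open scoped Matrix Polynomial Pointwise MonoidalCategory
open Literature.NumberTheory.GaloisRepresentations
open Literature.NumberTheory.Automorphic Literature.NumberTheory.Automorphic.UnitaryGroup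
open Literature.AlgebraicGeometry.ShimuraVarieties.UnitaryCanonicalModel
open Literature.NumberTheory.Automorphic.Liu2021.AppendixC
open Literature.AlgebraicGeometry.Motives (AlgPoints IntegralModel SchemeOver thickening thickeningGalAction thickeningLift specOver)
open Literature.NumberTheory.DiophantineGeometry (geomResidueField specialFibreFunctor specResidueField)
open Literature.NumberTheory.EllipticCurves (specGenericPoint)
open Literature.AlgebraicGeometry.RelativeSpec (ActionOver)
open Literature.AlgebraicGeometry.AbelianSchemes Literature.AlgebraicGeometry.AbelianSchemes.AbelianSchemeOver
open Summit.HodgeConjecture.HodgeConjecture.Cruxes.HLiu418.F0P6aModuliDatumDefs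
open Summit.HodgeConjecture.HodgeConjecture.Cruxes.HLiu418.F0P6aRGDAssembly
open Summit.HodgeConjecture.HodgeConjecture.Cruxes.HLiu418.F0P6aDatumOfInputs

section TranslReduction

open scoped MonObj CategoryTheory.Obj

-- the frame of the D-line՚s `Letters` section VERBATIM
variable {F : Type} [Field F] [NumberField F] [IsCMField F] {ι₁ : F →+* ℂ}
    {Jstar : Matrix (Fin 2) (Fin 2) F}
    {K₀ : C5.OpenCompactSubgroup ↥(finAdelic ↥(maximalRealSubfield F) F (IsCMField.complexConj F) 2 Jstar)}
    {S : RecordSystemGS F Jstar ι₁ K₀} {hU7ₛ : S.HeckeTranslateDefinedOver}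
    {hJ : (Jstar.map (IsCMField.complexConj F))ᵀ = Jstar} {hJu : IsUnit Jstar}
    {Fi : Type} [Field Fi] [Algebra F Fi] {Kc : C5.SmallLevel K₀} {G : Type} [Group G]
    {𝓜 : IntegralModel (𝓞 F) F ((thickening F Fi).obj (S.M.obj Kc))}
    {w : HeightOneSpectrum (𝓞 F)} {hw : (IsCMField.complexConj F) • w ≠ w} {h𝓨 : (𝓜.localise w).IsSmoothProper 1}
    {θ : ActionOver (𝓜.localise w).total.hom ((Fi ≃ₐ[F] Fi) × G)}
    {e : Fi →ₐ[F] AlgebraicClosure (w.adicCompletion F)}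

/-! ### §1 UPSTAIRS: the translate composite `v := q ≫ d_p` at the D-line's generic-fibre carriers -/

set_option maxHeartbeats 400000 in
set_option backward.isDefEq.respectTransparency false in
/-- (1a) **THE LEG `q` OF THE `⟨ϖ⟩`-ROOF IS SURJECTIVE** (★ `roof_legs_isFinite_surjective_of_polarization` at the D-line carriers: (r2) + (r3)-q + `c` surjective + `I.relDim` +
`p ∈ 𝔭_w`; the pin of `Â_y` from ★ `Polarization.nonempty_unitHatSlice_iso` at the generic fibre). [cite: MumfordAV1970, §19 Thm. 1 (p. 173)] [cite: GortzWedhorn2023, Prop. 27.176 and Cor. 27.177] -/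
theorem surjective_roofΩ_leg (I : RGDInputsAt F ι₁ Jstar K₀ S hU7ₛ hJ hJu Fi Kc G 𝓜 w hw h𝓨 θ e)
    (y y'' : AlgPoints (S.M.obj Kc) (AlgebraicClosure (w.adicCompletion F)))
    {B : AbelianSchemeOver (Spec (CommRingCat.of (AlgebraicClosure (w.adicCompletion F))))}
    (DB : B.DualPair) (lamB : B.X ⟶ DB.hat.X) [IsMonHom lamB]
    (hDBu : Nonempty ((Scheme.Modules.pullback DB.unitHatSlice).obj DB.P ≅ SheafOfModules.unit _))
    (q : (schΩOf S Kc 𝓜 w e I.univ y).X ⟶ B.X) [IsMonHom q] (c : (schΩOf S Kc 𝓜 w e I.univ y'').X ⟶ B.X) [IsMonHom c]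
    (hr2 : ∀ Pt : (fibreΩOf S Kc 𝓜 w e I.univ y'').Points (AlgebraicClosure (w.adicCompletion F)),
        (AlgPoints.map c Pt : B.toAffine.toAbelianVariety.Points (AlgebraicClosure (w.adicCompletion F))) = 1 ↔ IsIdealTorsionΩ S Kc 𝓜 w e I.univ I.act y'' w.asIdeal Pt)
    (hcsurj : Function.Surjective c.left.base)
    (hr3q : q ≫ lamB ≫ DualPair.dualIsogenyOver q (dualΩOf S Kc 𝓜 w e I.univ I.dual y) DB =
      (polΩOf S Kc 𝓜 w e I.univ I.pol y).lam ≫ (dualΩOf S Kc 𝓜 w e I.univ I.dual y).hat.mulN I.pChar) :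
    Surjective q.left := by
  have hp0 : I.pChar ≠ 0 := I.hpChar.1.ne_zero
  have hDx := (polΩOf S Kc 𝓜 w e I.univ I.pol y).nonempty_unitHatSlice_iso
  exact (roof_legs_isFinite_surjective_of_polarization (A := I.univ) (gA := I.g) (B := B) (O := 𝓞 F)
    (Ω := (AlgebraicClosure (w.adicCompletion F))) ((𝓜.localise w).genericIso'.inv.left ≫
            pullback.fst (𝓜.localise w).total.hom (specGenericPoint (HeightOneSpectrum.valuationSubringAtPrime F w) F))
    (thickeningLift e (S.M.obj Kc) y).left (thickeningLift e (S.M.obj Kc) y'').left I.relDim I.act I.dual I.pol DB hDBu hDx q c lamB hp0 hr3q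
    hp0 I.hpChar.2 (fun Pt hPt => (hr2 Pt).1 hPt) hcsurj).1

set_option maxHeartbeats 400000 in
set_option backward.isDefEq.respectTransparency false in
/-- (1b) **★ (C5a) AT THE D-LINE CARRIERS** (the roof's objects as binders; DIRECT term — no destructuring): the translate composite `v : A_y → A_{y″}` with the (C5a) rows, the
level row in the `lvlPtΩOf` currency `v(σ^i(y)) = σ^i(y″)^p`. [cite: Liu2021, Prop. D.8 (p. 135)] [cite: MumfordAV1970, §7 Thm. 4 (p. 72), §15 Thm. 1 (p. 143), §23 (p. 231)] -/
theorem exists_translCompositeΩ_of_legs (I : RGDInputsAt F ι₁ Jstar K₀ S hU7ₛ hJ hJu Fi Kc G 𝓜 w hw h𝓨 θ e)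
    (y y'' : AlgPoints (S.M.obj Kc) (AlgebraicClosure (w.adicCompletion F)))
    {B : AbelianSchemeOver (Spec (CommRingCat.of (AlgebraicClosure (w.adicCompletion F))))}
    (DB : B.DualPair) (lamB : B.X ⟶ DB.hat.X) [IsMonHom lamB]
    (hDBu : Nonempty ((Scheme.Modules.pullback DB.unitHatSlice).obj DB.P ≅ SheafOfModules.unit _))
    (q : (schΩOf S Kc 𝓜 w e I.univ y).X ⟶ B.X) [IsMonHom q] [Surjective q.left] (c : (schΩOf S Kc 𝓜 w e I.univ y'').X ⟶ B.X) [IsMonHom c]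
    (hr1 : ∀ Pt : (fibreΩOf S Kc 𝓜 w e I.univ y).Points (AlgebraicClosure (w.adicCompletion F)),
        (AlgPoints.map q Pt : B.toAffine.toAbelianVariety.Points (AlgebraicClosure (w.adicCompletion F))) = 1 ↔
          IsIdealTorsionΩ S Kc 𝓜 w e I.univ I.act y ((IsCMField.complexConj F) • w).asIdeal Pt)
    (hr2 : ∀ Pt : (fibreΩOf S Kc 𝓜 w e I.univ y'').Points (AlgebraicClosure (w.adicCompletion F)),
        (AlgPoints.map c Pt : B.toAffine.toAbelianVariety.Points (AlgebraicClosure (w.adicCompletion F))) = 1 ↔ IsIdealTorsionΩ S Kc 𝓜 w e I.univ I.act y'' w.asIdeal Pt)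
    (hcsurj : Function.Surjective c.left.base)
    (hr3q : q ≫ lamB ≫ DualPair.dualIsogenyOver q (dualΩOf S Kc 𝓜 w e I.univ I.dual y) DB =
      (polΩOf S Kc 𝓜 w e I.univ I.pol y).lam ≫ (dualΩOf S Kc 𝓜 w e I.univ I.dual y).hat.mulN I.pChar)
    (hr3c : c ≫ lamB ≫ DualPair.dualIsogenyOver c (dualΩOf S Kc 𝓜 w e I.univ I.dual y'') DB =
      (polΩOf S Kc 𝓜 w e I.univ I.pol y'').lam ≫ (dualΩOf S Kc 𝓜 w e I.univ I.dual y'').hat.mulN I.pChar)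
    (hr4 : ∀ a : 𝓞 F, ∃ b : B.X ⟶ B.X,
      (actΩOf S Kc 𝓜 w e I.univ I.act a y).hom.hom.hom ≫ q = q ≫ b ∧ (actΩOf S Kc 𝓜 w e I.univ I.act a y'').hom.hom.hom ≫ c = c ≫ b)
    (hr5 : ∀ a : Fin I.g ⊕ Fin I.g → ZMod I.N,
      (AlgPoints.map q (lvlPtΩOf S Kc 𝓜 w e I.univ I.lvl y a) : B.toAffine.toAbelianVariety.Points (AlgebraicClosure (w.adicCompletion F))) =
        AlgPoints.map c (lvlPtΩOf S Kc 𝓜 w e I.univ I.lvl y'' a))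
    (𝔮 : Ideal (𝓞 F)) (hpq : w.asIdeal * 𝔮 = Ideal.span {(I.pChar : 𝓞 F)}) :
    ∃ (v : (schΩOf S Kc 𝓜 w e I.univ y).X ⟶ (schΩOf S Kc 𝓜 w e I.univ y'').X) (_ : IsMonHom v), IsFinite v.left ∧ Surjective v.left ∧
      (∀ ⦃T : Over (Spec (.of (AlgebraicClosure (w.adicCompletion F))))⦄ (t : T ⟶ (schΩOf S Kc 𝓜 w e I.univ y).X),
        t ≫ v = 1 ↔ ∀ a ∈ ((IsCMField.complexConj F) • w).asIdeal * 𝔮,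
          t ≫ ((I.act.baseChange ((𝓜.localise w).genericIso'.inv.left ≫
            pullback.fst (𝓜.localise w).total.hom (specGenericPoint (HeightOneSpectrum.valuationSubringAtPrime F w) F))).baseChange (thickeningLift e (S.M.obj Kc) y).left).i a = 1) ∧
      v ≫ (polΩOf S Kc 𝓜 w e I.univ I.pol y'').lam ≫ DualPair.dualIsogenyOver v (dualΩOf S Kc 𝓜 w e I.univ I.dual y) (dualΩOf S Kc 𝓜 w e I.univ I.dual y'') =
        (polΩOf S Kc 𝓜 w e I.univ I.pol y).lam ≫ (dualΩOf S Kc 𝓜 w e I.univ I.dual y).hat.mulN (I.pChar * I.pChar) ∧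
      (∀ a : 𝓞 F,
        ((I.act.baseChange ((𝓜.localise w).genericIso'.inv.left ≫
            pullback.fst (𝓜.localise w).total.hom (specGenericPoint (HeightOneSpectrum.valuationSubringAtPrime F w) F))).baseChange (thickeningLift e (S.M.obj Kc) y).left).i a ≫ v =
          v ≫ ((I.act.baseChange ((𝓜.localise w).genericIso'.inv.left ≫
            pullback.fst (𝓜.localise w).total.hom (specGenericPoint (HeightOneSpectrum.valuationSubringAtPrime F w) F))).baseChange (thickeningLift e (S.M.obj Kc) y'').left).i a) ∧
      (∀ i : Fin I.g ⊕ Fin I.g → ZMod I.N,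
        (AlgPoints.map v (lvlPtΩOf S Kc 𝓜 w e I.univ I.lvl y i) :
            (schΩOf S Kc 𝓜 w e I.univ y'').toAffine.toAbelianVariety.Points (AlgebraicClosure (w.adicCompletion F))) =
          lvlPtΩOf S Kc 𝓜 w e I.univ I.lvl y'' i ^ I.pChar) :=
  exists_translComposite_of_roof
    ((I.act.baseChange ((𝓜.localise w).genericIso'.inv.left ≫
            pullback.fst (𝓜.localise w).total.hom (specGenericPoint (HeightOneSpectrum.valuationSubringAtPrime F w) F))).baseChange (thickeningLift e (S.M.obj Kc) y).left)
    ((I.act.baseChange ((𝓜.localise w).genericIso'.inv.left ≫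
            pullback.fst (𝓜.localise w).total.hom (specGenericPoint (HeightOneSpectrum.valuationSubringAtPrime F w) F))).baseChange (thickeningLift e (S.M.obj Kc) y'').left)
    (dualΩOf S Kc 𝓜 w e I.univ I.dual y) (polΩOf S Kc 𝓜 w e I.univ I.pol y) (dualΩOf S Kc 𝓜 w e I.univ I.dual y'') (polΩOf S Kc 𝓜 w e I.univ I.pol y'')
    DB lamB q c w.asIdeal (((IsCMField.complexConj F) • w).asIdeal) 𝔮 w.ne_bot ((IsCMField.complexConj F) • w).ne_bot I.hpChar.1.ne_zero hpq hDBu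
    hr1 hr2 hcsurj hr3q hr3c hr4
    (fun i => lvlPtΩOf S Kc 𝓜 w e I.univ I.lvl y i) (fun i => lvlPtΩOf S Kc 𝓜 w e I.univ I.lvl y'' i) hr5

set_option maxHeartbeats 400000 in
set_option backward.isDefEq.respectTransparency false in
/-- (1c) **THE LEVEL ROW RE-READ ON `sectionBaseChange`** (★ (ν8k) (iii)'s premiss currency): `v(σ^i(y)) = σ^i(y″)^p` in the `lvlPtΩOf` currency becomes
`v((σ^i ×_𝓨 η)(ℓ y)) = (((σ^i)^p) ×_𝓨 η)(ℓ y″)` (★ `LevelStructure.baseChange_section_`, ★ `restrictPt_pow`, `map_pow`; `congrArg` chains, no `rw` across the tower).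
[cite: MumfordFogartyKirwan1994, Ch. 7 §2 Definition 7.2 (p. 129)] -/
theorem map_restrictPt_sectionBaseChange_of_lvlPtΩ (I : RGDInputsAt F ι₁ Jstar K₀ S hU7ₛ hJ hJu Fi Kc G 𝓜 w hw h𝓨 θ e)
    (y y'' : AlgPoints (S.M.obj Kc) (AlgebraicClosure (w.adicCompletion F)))
    (v : (schΩOf S Kc 𝓜 w e I.univ y).X ⟶ (schΩOf S Kc 𝓜 w e I.univ y'').X) {n : ℕ} (i : Fin I.g ⊕ Fin I.g → ZMod I.N)
    (h : (AlgPoints.map v (lvlPtΩOf S Kc 𝓜 w e I.univ I.lvl y i) :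
            (schΩOf S Kc 𝓜 w e I.univ y'').toAffine.toAbelianVariety.Points (AlgebraicClosure (w.adicCompletion F))) =
          lvlPtΩOf S Kc 𝓜 w e I.univ I.lvl y'' i ^ n) :
    AlgPoints.map v ((I.univ.baseChange ((𝓜.localise w).genericIso'.inv.left ≫
            pullback.fst (𝓜.localise w).total.hom (specGenericPoint (HeightOneSpectrum.valuationSubringAtPrime F w) F))).restrictPt (thickeningLift e (S.M.obj Kc) y).left
        (I.univ.sectionBaseChange ((𝓜.localise w).genericIso'.inv.left ≫
            pullback.fst (𝓜.localise w).total.hom (specGenericPoint (HeightOneSpectrum.valuationSubringAtPrime F w) F)) (I.lvl.section_ i))) =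
      (I.univ.baseChange ((𝓜.localise w).genericIso'.inv.left ≫
            pullback.fst (𝓜.localise w).total.hom (specGenericPoint (HeightOneSpectrum.valuationSubringAtPrime F w) F))).restrictPt (thickeningLift e (S.M.obj Kc) y'').left
        (I.univ.sectionBaseChange ((𝓜.localise w).genericIso'.inv.left ≫
            pullback.fst (𝓜.localise w).total.hom (specGenericPoint (HeightOneSpectrum.valuationSubringAtPrime F w) F)) (I.lvl.section_ i ^ n)) := by
  have e₁ := congrArg ((I.univ.baseChange ((𝓜.localise w).genericIso'.inv.left ≫
            pullback.fst (𝓜.localise w).total.hom (specGenericPoint (HeightOneSpectrum.valuationSubringAtPrime F w) F))).restrictPt (thickeningLift e (S.M.obj Kc) y).left)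
    (LevelStructure.baseChange_section_ ((𝓜.localise w).genericIso'.inv.left ≫
            pullback.fst (𝓜.localise w).total.hom (specGenericPoint (HeightOneSpectrum.valuationSubringAtPrime F w) F)) I.lvl i)
  have e₂ := congrArg ((I.univ.baseChange ((𝓜.localise w).genericIso'.inv.left ≫
            pullback.fst (𝓜.localise w).total.hom (specGenericPoint (HeightOneSpectrum.valuationSubringAtPrime F w) F))).restrictPt (thickeningLift e (S.M.obj Kc) y'').left)
    (LevelStructure.baseChange_section_ ((𝓜.localise w).genericIso'.inv.left ≫
            pullback.fst (𝓜.localise w).total.hom (specGenericPoint (HeightOneSpectrum.valuationSubringAtPrime F w) F)) I.lvl i)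
  exact (congrArg (AlgPoints.map v) e₁).symm.trans (h.trans ((congrArg (· ^ n) e₂).trans
    ((restrictPt_pow _ _ _ _).symm.trans (congrArg ((I.univ.baseChange ((𝓜.localise w).genericIso'.inv.left ≫
            pullback.fst (𝓜.localise w).total.hom (specGenericPoint (HeightOneSpectrum.valuationSubringAtPrime F w) F))).restrictPt (thickeningLift e (S.M.obj Kc) y'').left)
      (map_pow _ (I.lvl.section_ i) n).symm))))

/-! ### §2 DOWNSTAIRS: the reduced homomorphism at one `y` -/

set_option maxHeartbeats 400000 in
set_option backward.isDefEq.respectTransparency false in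
/-- (2a) **★ (ν8k) ED. 2 ON A TRANSLATE COMPOSITE, NATIVE CURRENCY** (the composite `v` and its rows as binders, in (1b)'s output currency): the reduced homomorphism `r` of
the special fibres (`((I.univ ×_𝓨 𝓨_s) ×_{𝓨_s} red(ℓ y))`-carriers), FINITE (its kernel points are killed by `N ∈ 𝔞`, ★ `natCast_mem_of_quasiInverse`, ★
`isFinite_left_of_surjective_of_forall_points`) and SURJECTIVE, with the rows (v′)(iv)(ii-ι)(iii) of ★ (ν8k) as delivered (no currency change).
[cite: SerreTate1968, §1 Lemma 2] [cite: BoschLutkebohmertRaynaud1990, §7.3 Prop. 6 (p. 180)] [cite: MumfordAV1970, §7 Thm. 4 (p. 72), §15 Thm. 1 (p. 143)] -/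
theorem exists_translReduction_native_of_composite (I : RGDInputsAt F ι₁ Jstar K₀ S hU7ₛ hJ hJu Fi Kc G 𝓜 w hw h𝓨 θ e)
    (y y'' : AlgPoints (S.M.obj Kc) (AlgebraicClosure (w.adicCompletion F))) (𝔞 : Ideal (𝓞 F))
    {m : ℕ} (E : Matrix (Fin m) (Fin m) (𝓞 F)) (hE : E * E = E) (Pm : Matrix (Fin m) (Fin 1) (𝓞 F)) (Qm : Matrix (Fin 1) (Fin m) (𝓞 F)) {N : ℕ}
    (hN : N ≠ 0) (hP : E * Pm = Pm) (hQ : Qm * E = Qm) (hQP : Qm * Pm = Matrix.scalar (Fin 1) (N : 𝓞 F)) (hPQ : Pm * Qm = Matrix.scalar (Fin m) (N : 𝓞 F) * E)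
    (hspan : Ideal.span (Set.range fun k => Pm k 0) = 𝔞)
    (v : (schΩOf S Kc 𝓜 w e I.univ y).X ⟶ (schΩOf S Kc 𝓜 w e I.univ y'').X) [IsMonHom v] [IsFinite v.left] [Surjective v.left]
    (hvker : ∀ ⦃T : Over (Spec (.of (AlgebraicClosure (w.adicCompletion F))))⦄ (t : T ⟶ (schΩOf S Kc 𝓜 w e I.univ y).X),
        t ≫ v = 1 ↔ ∀ a ∈ 𝔞, t ≫ ((I.act.baseChange ((𝓜.localise w).genericIso'.inv.left ≫
            pullback.fst (𝓜.localise w).total.hom (specGenericPoint (HeightOneSpectrum.valuationSubringAtPrime F w) F))).baseChange (thickeningLift e (S.M.obj Kc) y).left).i a = 1)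
    {M : ℕ}
    (hvsim : v ≫ (polΩOf S Kc 𝓜 w e I.univ I.pol y'').lam ≫ DualPair.dualIsogenyOver v (dualΩOf S Kc 𝓜 w e I.univ I.dual y) (dualΩOf S Kc 𝓜 w e I.univ I.dual y'') =
        (polΩOf S Kc 𝓜 w e I.univ I.pol y).lam ≫ (dualΩOf S Kc 𝓜 w e I.univ I.dual y).hat.mulN M)
    (hvact : ∀ a : 𝓞 F,
        ((I.act.baseChange ((𝓜.localise w).genericIso'.inv.left ≫
            pullback.fst (𝓜.localise w).total.hom (specGenericPoint (HeightOneSpectrum.valuationSubringAtPrime F w) F))).baseChange (thickeningLift e (S.M.obj Kc) y).left).i a ≫ v =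
          v ≫ ((I.act.baseChange ((𝓜.localise w).genericIso'.inv.left ≫
            pullback.fst (𝓜.localise w).total.hom (specGenericPoint (HeightOneSpectrum.valuationSubringAtPrime F w) F))).baseChange (thickeningLift e (S.M.obj Kc) y'').left).i a)
    {n : ℕ}
    (hvlvl : ∀ i : Fin I.g ⊕ Fin I.g → ZMod I.N,
        AlgPoints.map v ((I.univ.baseChange ((𝓜.localise w).genericIso'.inv.left ≫
            pullback.fst (𝓜.localise w).total.hom (specGenericPoint (HeightOneSpectrum.valuationSubringAtPrime F w) F))).restrictPt (thickeningLift e (S.M.obj Kc) y).left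
            (I.univ.sectionBaseChange ((𝓜.localise w).genericIso'.inv.left ≫
            pullback.fst (𝓜.localise w).total.hom (specGenericPoint (HeightOneSpectrum.valuationSubringAtPrime F w) F)) (I.lvl.section_ i))) =
          (I.univ.baseChange ((𝓜.localise w).genericIso'.inv.left ≫
            pullback.fst (𝓜.localise w).total.hom (specGenericPoint (HeightOneSpectrum.valuationSubringAtPrime F w) F))).restrictPt (thickeningLift e (S.M.obj Kc) y'').left
            (I.univ.sectionBaseChange ((𝓜.localise w).genericIso'.inv.left ≫
            pullback.fst (𝓜.localise w).total.hom (specGenericPoint (HeightOneSpectrum.valuationSubringAtPrime F w) F)) (I.lvl.section_ i ^ n))) :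
    haveI : IsProper (𝓜.localise w).total.hom := h𝓨.2
    ∃ (r : ((I.univ.baseChange (pullback.fst (𝓜.localise w).total.hom (specResidueField w))).baseChange ((𝓜.localise w).geomReductionMap (thickeningLift e (S.M.obj Kc) y)).left).X ⟶ ((I.univ.baseChange (pullback.fst (𝓜.localise w).total.hom (specResidueField w))).baseChange ((𝓜.localise w).geomReductionMap (thickeningLift e (S.M.obj Kc) y'')).left).X) (_ : IsMonHom r)
      (_ : IsFinite r.left) (_ : Surjective r.left),
      (∀ ⦃T : Over (Spec (.of (geomResidueField w)))⦄ (t : T ⟶ ((I.univ.baseChange (pullback.fst (𝓜.localise w).total.hom (specResidueField w))).baseChange ((𝓜.localise w).geomReductionMap (thickeningLift e (S.M.obj Kc) y)).left).X),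
          t ≫ r = 1 ↔ ∀ a ∈ 𝔞, t ≫ ((I.act.baseChange (pullback.fst (𝓜.localise w).total.hom (specResidueField w))).baseChange ((𝓜.localise w).geomReductionMap (thickeningLift e (S.M.obj Kc) y)).left).i a = 1) ∧
      r ≫ ((I.pol.baseChange (pullback.fst (𝓜.localise w).total.hom (specResidueField w))).baseChange ((𝓜.localise w).geomReductionMap (thickeningLift e (S.M.obj Kc) y'')).left).lam ≫
          DualPair.dualIsogenyOver r ((I.dual.baseChange (pullback.fst (𝓜.localise w).total.hom (specResidueField w))).baseChange ((𝓜.localise w).geomReductionMap (thickeningLift e (S.M.obj Kc) y)).left) ((I.dual.baseChange (pullback.fst (𝓜.localise w).total.hom (specResidueField w))).baseChange ((𝓜.localise w).geomReductionMap (thickeningLift e (S.M.obj Kc) y'')).left) =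
        ((I.pol.baseChange (pullback.fst (𝓜.localise w).total.hom (specResidueField w))).baseChange ((𝓜.localise w).geomReductionMap (thickeningLift e (S.M.obj Kc) y)).left).lam ≫ ((I.dual.baseChange (pullback.fst (𝓜.localise w).total.hom (specResidueField w))).baseChange ((𝓜.localise w).geomReductionMap (thickeningLift e (S.M.obj Kc) y)).left).hat.mulN M ∧
      (∀ a : 𝓞 F, ((I.act.baseChange (pullback.fst (𝓜.localise w).total.hom (specResidueField w))).baseChange ((𝓜.localise w).geomReductionMap (thickeningLift e (S.M.obj Kc) y)).left).i a ≫ r = r ≫ ((I.act.baseChange (pullback.fst (𝓜.localise w).total.hom (specResidueField w))).baseChange ((𝓜.localise w).geomReductionMap (thickeningLift e (S.M.obj Kc) y'')).left).i a) ∧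
      (∀ i : Fin I.g ⊕ Fin I.g → ZMod I.N,
          AlgPoints.map r ((I.univ.baseChange (pullback.fst (𝓜.localise w).total.hom (specResidueField w))).restrictPt ((𝓜.localise w).geomReductionMap (thickeningLift e (S.M.obj Kc) y)).left (I.univ.sectionBaseChange (pullback.fst (𝓜.localise w).total.hom (specResidueField w)) (I.lvl.section_ i))) =
            (I.univ.baseChange (pullback.fst (𝓜.localise w).total.hom (specResidueField w))).restrictPt ((𝓜.localise w).geomReductionMap (thickeningLift e (S.M.obj Kc) y'')).left (I.univ.sectionBaseChange (pullback.fst (𝓜.localise w).total.hom (specResidueField w)) (I.lvl.section_ i ^ n))) := by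
  haveI : IsCommMonObj I.univ.X := I.comm
  -- HEAD-ROOM CURE (LA2-p04 (g8); proof body only — statement, binders, docstring, budget line byte-identical): NO tactic-level `IsProper`
  -- instance.  The statement inlines `haveI := h𝓨.2`, so its `geomReductionMap` terms carry `h𝓨.2` itself, while a local `haveI` made every
  -- ★-instantiated row carry the hypothesis `this` instead; the closing `exact` then paid three NON-syntactic unifications over ≈ 3·10⁶-node
  -- types (62 k + 100 k + 69 k heartbeat units for (v′), (iv), (ii-ι)).  Passing `h𝓨.2` to ★ (ν8k) explicitly (and letting the action
  -- argument of ★ `isFinite_left_of_surjective_of_forall_points` be read off `hker`) makes those rows syntactically identical to the goal: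
  -- 379 553 → 156 195 by import (94.9 % → 39.0 % of 400 000; HOME probes `T203.probe.v1…v4`).
  -- ★ (ν8k) ED. 2 (accessed by `Exists.elim` + projections — no `obtain` on the 7-row ∃, finding (F13))
  have h := @exists_specialFibre_hom_reduction_ker_ringAction F _ _ w _ (𝓜.localise w) h𝓨.2 I.univ I.univ
    (thickeningLift e (S.M.obj Kc) y) (thickeningLift e (S.M.obj Kc) y'') v _ (𝓞 F) _ I.act I.act _ m E hE Pm Qm N hN hP hQ hQP hPQ 𝔞 hspan hvker
  refine h.elim fun r hr => hr.elim fun hrmon hrows => ?_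
  haveI := hrmon
  have hfs := hrows.1 inferInstance inferInstance
  haveI hrsurj : Surjective r.left := ⟨hfs.2⟩
  have hker := hrows.2.2.2.2.2 inferInstance inferInstance
  have hN𝔞 : ((N : ℕ) : 𝓞 F) ∈ 𝔞 := natCast_mem_of_quasiInverse Pm Qm hQP hspan
  haveI hrfin : IsFinite r.left := isFinite_left_of_surjective_of_forall_points _ r hN hN𝔞 (fun Pt hPt => (hker Pt).1 hPt)
  exact ⟨r, hrmon, hrfin, hrsurj, hker, hrows.2.2.2.2.1 I.dual I.pol I.dual I.pol M hvsim, fun a => hrows.2.2.1 a (hvact a),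
    fun i => hrows.2.2.2.1 (I.lvl.section_ i) (I.lvl.section_ i ^ n) (hvlvl i)⟩

set_option maxHeartbeats 400000 in
set_option backward.isDefEq.respectTransparency false in
/-- (2b) **THE REDUCED TRANSLATE HOMOMORPHISM AT ONE `y`, NATIVE CURRENCY** — from `RoofΩ` at `(y, y″)` through `K₂ = A_y[𝔭_{c•w}]`, `(p) = 𝔭_w𝔮` and a Serre presentation of
`𝔞 := 𝔭_{c•w}·𝔮`: (1a) + (1b) + (1c) + (2a). [cite: Liu2021, Prop. D.8 (p. 135)] [cite: SerreTate1968, §1 Lemma 2] -/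
theorem exists_translReduction_native (I : RGDInputsAt F ι₁ Jstar K₀ S hU7ₛ hJ hJu Fi Kc G 𝓜 w hw h𝓨 θ e)
    (y y'' : AlgPoints (S.M.obj Kc) (AlgebraicClosure (w.adicCompletion F)))
    (K₂ : Subgroup ((fibreΩOf S Kc 𝓜 w e I.univ y).Points (AlgebraicClosure (w.adicCompletion F))))
    (hK₂ : ∀ P, P ∈ K₂ ↔ IsIdealTorsionΩ S Kc 𝓜 w e I.univ I.act y ((IsCMField.complexConj F) • w).asIdeal P)
    (hR : RoofΩ S Kc 𝓜 w e I.univ I.act I.dual I.pol I.lvl I.pChar w.asIdeal y y'' K₂)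
    (𝔮 : Ideal (𝓞 F)) (hpq : w.asIdeal * 𝔮 = Ideal.span {(I.pChar : 𝓞 F)})
    {m : ℕ} (E : Matrix (Fin m) (Fin m) (𝓞 F)) (hE : E * E = E) (Pm : Matrix (Fin m) (Fin 1) (𝓞 F)) (Qm : Matrix (Fin 1) (Fin m) (𝓞 F)) {N : ℕ}
    (hN : N ≠ 0) (hP : E * Pm = Pm) (hQ : Qm * E = Qm) (hQP : Qm * Pm = Matrix.scalar (Fin 1) (N : 𝓞 F)) (hPQ : Pm * Qm = Matrix.scalar (Fin m) (N : 𝓞 F) * E)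
    (hspan : Ideal.span (Set.range fun k => Pm k 0) = ((IsCMField.complexConj F) • w).asIdeal * 𝔮) :
    haveI : IsProper (𝓜.localise w).total.hom := h𝓨.2
    ∃ (r : ((I.univ.baseChange (pullback.fst (𝓜.localise w).total.hom (specResidueField w))).baseChange ((𝓜.localise w).geomReductionMap (thickeningLift e (S.M.obj Kc) y)).left).X ⟶ ((I.univ.baseChange (pullback.fst (𝓜.localise w).total.hom (specResidueField w))).baseChange ((𝓜.localise w).geomReductionMap (thickeningLift e (S.M.obj Kc) y'')).left).X) (_ : IsMonHom r)
      (_ : IsFinite r.left) (_ : Surjective r.left),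
      (∀ ⦃T : Over (Spec (.of (geomResidueField w)))⦄ (t : T ⟶ ((I.univ.baseChange (pullback.fst (𝓜.localise w).total.hom (specResidueField w))).baseChange ((𝓜.localise w).geomReductionMap (thickeningLift e (S.M.obj Kc) y)).left).X),
          t ≫ r = 1 ↔ ∀ a ∈ ((IsCMField.complexConj F) • w).asIdeal * 𝔮, t ≫ ((I.act.baseChange (pullback.fst (𝓜.localise w).total.hom (specResidueField w))).baseChange ((𝓜.localise w).geomReductionMap (thickeningLift e (S.M.obj Kc) y)).left).i a = 1) ∧
      r ≫ ((I.pol.baseChange (pullback.fst (𝓜.localise w).total.hom (specResidueField w))).baseChange ((𝓜.localise w).geomReductionMap (thickeningLift e (S.M.obj Kc) y'')).left).lam ≫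
          DualPair.dualIsogenyOver r ((I.dual.baseChange (pullback.fst (𝓜.localise w).total.hom (specResidueField w))).baseChange ((𝓜.localise w).geomReductionMap (thickeningLift e (S.M.obj Kc) y)).left) ((I.dual.baseChange (pullback.fst (𝓜.localise w).total.hom (specResidueField w))).baseChange ((𝓜.localise w).geomReductionMap (thickeningLift e (S.M.obj Kc) y'')).left) =
        ((I.pol.baseChange (pullback.fst (𝓜.localise w).total.hom (specResidueField w))).baseChange ((𝓜.localise w).geomReductionMap (thickeningLift e (S.M.obj Kc) y)).left).lam ≫ ((I.dual.baseChange (pullback.fst (𝓜.localise w).total.hom (specResidueField w))).baseChange ((𝓜.localise w).geomReductionMap (thickeningLift e (S.M.obj Kc) y)).left).hat.mulN (I.pChar * I.pChar) ∧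
      (∀ a : 𝓞 F, ((I.act.baseChange (pullback.fst (𝓜.localise w).total.hom (specResidueField w))).baseChange ((𝓜.localise w).geomReductionMap (thickeningLift e (S.M.obj Kc) y)).left).i a ≫ r = r ≫ ((I.act.baseChange (pullback.fst (𝓜.localise w).total.hom (specResidueField w))).baseChange ((𝓜.localise w).geomReductionMap (thickeningLift e (S.M.obj Kc) y'')).left).i a) ∧
      (∀ i : Fin I.g ⊕ Fin I.g → ZMod I.N,
          AlgPoints.map r ((I.univ.baseChange (pullback.fst (𝓜.localise w).total.hom (specResidueField w))).restrictPt ((𝓜.localise w).geomReductionMap (thickeningLift e (S.M.obj Kc) y)).left (I.univ.sectionBaseChange (pullback.fst (𝓜.localise w).total.hom (specResidueField w)) (I.lvl.section_ i))) =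
            (I.univ.baseChange (pullback.fst (𝓜.localise w).total.hom (specResidueField w))).restrictPt ((𝓜.localise w).geomReductionMap (thickeningLift e (S.M.obj Kc) y'')).left (I.univ.sectionBaseChange (pullback.fst (𝓜.localise w).total.hom (specResidueField w)) (I.lvl.section_ i ^ I.pChar))) := by
  -- the roof's objects ONCE (`Exists.elim` + projections, no `obtain` — finding (F13)), then (1a) + (1b) + (2a) with the level row re-read by (1c)
  refine hR.elim fun B h₁ => h₁.elim fun DB h₂ => h₂.elim fun lamB h₃ => h₃.elim fun hlamB h₄ => h₄.elim fun hDBu h₅ =>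
    h₅.elim fun q h₆ => h₆.elim fun hq h₇ => h₇.elim fun c h₈ => h₈.elim fun hc hrows => ?_
  haveI := hlamB
  haveI := hq
  haveI := hc
  haveI := surjective_roofΩ_leg I y y'' DB lamB hDBu q c hrows.2.1 hrows.2.2.1 hrows.2.2.2.1
  have hv := exists_translCompositeΩ_of_legs I y y'' DB lamB hDBu q c
    (fun Pt => (hrows.1 Pt).trans (hK₂ Pt)) hrows.2.1 hrows.2.2.1 hrows.2.2.2.1 hrows.2.2.2.2.1 hrows.2.2.2.2.2.1 hrows.2.2.2.2.2.2 𝔮 hpq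
  refine hv.elim fun v hv₁ => hv₁.elim fun hvmon hvrows => ?_
  haveI := hvmon
  haveI := hvrows.1
  haveI := hvrows.2.1
  exact exists_translReduction_native_of_composite I y y'' _ E hE Pm Qm hN hP hQ hQP hPQ hspan v hvrows.2.2.1 hvrows.2.2.2.1 hvrows.2.2.2.2.1
    (fun i => map_restrictPt_sectionBaseChange_of_lvlPtΩ I y y'' v i (hvrows.2.2.2.2.2 i))

set_option maxHeartbeats 400000 in
set_option backward.isDefEq.respectTransparency false in
/-- (2c) **`exists_translReduction_at` — THE REDUCED TRANSLATE HOMOMORPHISM AT ONE `y`, (α)-CURRENCY.**  (2b) re-read through the D-line readers: `red₀Of … = geomReductionMap (ℓ_e ·)`,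
`sch₀Of`∕`act₀Of`∕`pol₀Of`∕`dual₀Of` unfold by `rfl`; the level row is moved from `sectionBaseChange π_s (σ^i)` to `lvlPt₀Of` (= `restrictPt … ((lvl ×_𝓨 𝓨_s).section_ i)`) by ★
`LevelStructure.baseChange_section_`, ★ `restrictPt_pow`, `map_pow` (`congrArg` chains). [cite: SerreTate1968, §1 Lemma 2] [cite: BoschLutkebohmertRaynaud1990, §7.3 Prop. 6 (p. 180)]
[cite: MumfordAV1970, §23 Thm. 2 (p. 231); §15 Thm. 1 (p. 143); §7 Thm. 4 (p. 72)] [cite: Liu2021, Prop. D.8 p. 135] -/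
theorem exists_translReduction_at (I : RGDInputsAt F ι₁ Jstar K₀ S hU7ₛ hJ hJu Fi Kc G 𝓜 w hw h𝓨 θ e)
    (y y'' : AlgPoints (S.M.obj Kc) (AlgebraicClosure (w.adicCompletion F)))
    (K₂ : Subgroup ((fibreΩOf S Kc 𝓜 w e I.univ y).Points (AlgebraicClosure (w.adicCompletion F))))
    (hK₂ : ∀ P, P ∈ K₂ ↔ IsIdealTorsionΩ S Kc 𝓜 w e I.univ I.act y ((IsCMField.complexConj F) • w).asIdeal P)
    (hR : RoofΩ S Kc 𝓜 w e I.univ I.act I.dual I.pol I.lvl I.pChar w.asIdeal y y'' K₂)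
    (𝔮 : Ideal (𝓞 F)) (hpq : w.asIdeal * 𝔮 = Ideal.span {(I.pChar : 𝓞 F)})
    {m : ℕ} (E : Matrix (Fin m) (Fin m) (𝓞 F)) (hE : E * E = E) (Pm : Matrix (Fin m) (Fin 1) (𝓞 F)) (Qm : Matrix (Fin 1) (Fin m) (𝓞 F)) {N : ℕ}
    (hN : N ≠ 0) (hP : E * Pm = Pm) (hQ : Qm * E = Qm) (hQP : Qm * Pm = Matrix.scalar (Fin 1) (N : 𝓞 F)) (hPQ : Pm * Qm = Matrix.scalar (Fin m) (N : 𝓞 F) * E)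
    (hspan : Ideal.span (Set.range fun k => Pm k 0) = ((IsCMField.complexConj F) • w).asIdeal * 𝔮) :
    ∃ (r : (sch₀Of 𝓜 w I.univ (red₀Of S Kc 𝓜 w h𝓨 e y)).X ⟶ (sch₀Of 𝓜 w I.univ (red₀Of S Kc 𝓜 w h𝓨 e y'')).X) (_ : IsMonHom r)
      (_ : IsFinite r.left) (_ : Surjective r.left),
      (∀ ⦃T : SchemeOver (geomResidueField w)⦄ (t : T ⟶ (sch₀Of 𝓜 w I.univ (red₀Of S Kc 𝓜 w h𝓨 e y)).X),
          t ≫ r = 1 ↔ ∀ a ∈ ((IsCMField.complexConj F) • w).asIdeal * 𝔮, t ≫ (act₀Of 𝓜 w I.univ I.act a (red₀Of S Kc 𝓜 w h𝓨 e y)).hom.hom.hom = 1) ∧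
      r ≫ (pol₀Of 𝓜 w I.univ I.pol (red₀Of S Kc 𝓜 w h𝓨 e y'')).lam ≫
          DualPair.dualIsogenyOver r (dual₀Of 𝓜 w I.univ I.dual (red₀Of S Kc 𝓜 w h𝓨 e y)) (dual₀Of 𝓜 w I.univ I.dual (red₀Of S Kc 𝓜 w h𝓨 e y'')) =
        (pol₀Of 𝓜 w I.univ I.pol (red₀Of S Kc 𝓜 w h𝓨 e y)).lam ≫ (dual₀Of 𝓜 w I.univ I.dual (red₀Of S Kc 𝓜 w h𝓨 e y)).hat.mulN (I.pChar * I.pChar) ∧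
      (∀ a : 𝓞 F, (act₀Of 𝓜 w I.univ I.act a (red₀Of S Kc 𝓜 w h𝓨 e y)).hom.hom.hom ≫ r =
          r ≫ (act₀Of 𝓜 w I.univ I.act a (red₀Of S Kc 𝓜 w h𝓨 e y'')).hom.hom.hom) ∧
      (∀ i : Fin I.g ⊕ Fin I.g → ZMod I.N,
          (AlgPoints.map r (lvlPt₀Of 𝓜 w I.univ I.lvl (red₀Of S Kc 𝓜 w h𝓨 e y) i) :
              (fibre₀Of 𝓜 w I.univ (red₀Of S Kc 𝓜 w h𝓨 e y'')).Points (geomResidueField w)) =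
            lvlPt₀Of 𝓜 w I.univ I.lvl (red₀Of S Kc 𝓜 w h𝓨 e y'') i ^ I.pChar) := by
  haveI : IsProper (𝓜.localise w).total.hom := h𝓨.2
  have h := exists_translReduction_native I y y'' K₂ hK₂ hR 𝔮 hpq E hE Pm Qm hN hP hQ hQP hPQ hspan
  refine h.elim fun r h₁ => h₁.elim fun hrmon h₂ => h₂.elim fun hrfin h₃ => h₃.elim fun hrsurj hrows => ?_
  refine ⟨r, hrmon, hrfin, hrsurj, hrows.1, hrows.2.1, hrows.2.2.1, fun i => ?_⟩
  have hlvl := hrows.2.2.2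
  -- (LVL) re-read on `(lvl ×_𝓨 𝓨_s).section_` (`lvlPt₀Of` by `rfl`)
  have e₁ := congrArg ((I.univ.baseChange (pullback.fst (𝓜.localise w).total.hom (specResidueField w))).restrictPt ((𝓜.localise w).geomReductionMap (thickeningLift e (S.M.obj Kc) y)).left) (LevelStructure.baseChange_section_ (pullback.fst (𝓜.localise w).total.hom (specResidueField w)) I.lvl i)
  have e₂ := congrArg ((I.univ.baseChange (pullback.fst (𝓜.localise w).total.hom (specResidueField w))).restrictPt ((𝓜.localise w).geomReductionMap (thickeningLift e (S.M.obj Kc) y'')).left) (LevelStructure.baseChange_section_ (pullback.fst (𝓜.localise w).total.hom (specResidueField w)) I.lvl i)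
  exact (congrArg (AlgPoints.map r) e₁).trans ((hlvl i).trans ((congrArg ((I.univ.baseChange (pullback.fst (𝓜.localise w).total.hom (specResidueField w))).restrictPt ((𝓜.localise w).geomReductionMap (thickeningLift e (S.M.obj Kc) y'')).left)
      (map_pow _ (I.lvl.section_ i) I.pChar)).trans ((restrictPt_pow _ _ _ _).trans (congrArg (· ^ I.pChar) e₂.symm))))

/-! ### §3 (C5) THE HEAD — statement of record (LA6-p03 (g2) 4fdc17d6 + (O1) `hpN` LAST), PAID -/

end TranslReduction

end Block_T5

end Summit.HodgeConjecture.HodgeConjecture.Cruxes.HLiu418.F0P6aLineSpecialisation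

end
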